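import Summits.Ventures.QEC.Census.BB.BBRows
import Literature.InformationTheory.QuantumCodes.BivariateBicycleCode756
import HarnessLib

/-!
# `[[756,16,≤34]]` check rows: the kernel-computed words of `BB.bb756` and their identities (no numerals)

The check matrices `H^X = [A|B]`, `H^Z = [Bᵀ|Aᵀ]` of the seventh BCGMRY24 Table-3 code `BB.bb756` = `QC(x³+y¹⁰+y¹⁷, y⁵+x³+x¹⁹)`
on `ℤ₂₁ × ℤ₁₈` (`Literature/InformationTheory/QuantumCodes/BivariateBicycleCode756.lean`) as ROW WORDS computed in the kernel
by the verified generator of `Census/BB/BBRows.lean` from the monomial lists `la756`, `lb756`, with the identities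
`rowMatrix 756 (rowsX la756 lb756) = BB.bb756.HXFlat` / `… rowsZ … = HZFlat` as ONE-LINE instances of `BBRows.rowMatrix_rowsX/Z`
(no decimal numerals, no entrywise `decide`: at `n = 756` the entrywise identity of the `BB360Data` pattern — 2 × 285 768
entries — would not fit one file's kernel budget). Plus the commutation of the words read through the identities.
Consumers: `Census/BB/BB756RankX.lean`, `BB756RankZ.lean` (`k = 16`), `Census/BB/BB756Bound.lean` (`d ≤ 40`).

HONEST FRAMING: plumbing + two identities; nothing here certifies `k` or the distance of `BB.bb756`.
-/

namespace Summit.Ventures.QEC.Census.BB756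

open Matrix Literature.InformationTheory.QuantumCodes BBRows

/-- Monomials of `BB.bb756.A = x³ + y¹⁰ + y¹⁷` on `ℤ₂₁ × ℤ₁₈`. -/
def la756 : List (BB.Mono 21 18) := [(Fin.ofNat 21 3, 0), (0, Fin.ofNat 18 10), (0, Fin.ofNat 18 17)]

/-- Monomials of `BB.bb756.B = y⁵ + x³ + x¹⁹` on `ℤ₂₁ × ℤ₁₈`. -/
def lb756 : List (BB.Mono 21 18) := [(0, Fin.ofNat 18 5), (Fin.ofNat 21 3, 0), (Fin.ofNat 21 19, 0)]

/-- `BB.bb756.A = polyL la756` (unfolding `xPow`/`yPow`). -/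
theorem bb756_A : BB.bb756.A = polyL la756 := by
  simp only [BB.bb756, polyL, la756, List.map, List.sum_cons, List.sum_nil, add_zero, BB.xPow, BB.yPow, add_assoc]

/-- `BB.bb756.B = polyL lb756`. -/
theorem bb756_B : BB.bb756.B = polyL lb756 := by
  simp only [BB.bb756, polyL, lb756, List.map, List.sum_cons, List.sum_nil, add_zero, BB.xPow, BB.yPow, add_assoc]

set_option maxRecDepth 100000 in -- the statement's index types unfold a 378-element `List.ofFn`
/-- **`rowMatrix 756 (rowsX la756 lb756) = BB.bb756.HXFlat`** — the kernel-computed `X`-check words ARE the typed flat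
check matrix (instance of `BBRows.rowMatrix_rowsX`). -/
theorem rowsX_bb756 : rowMatrix 756 (rowsX la756 lb756) = BB.bb756.HXFlat :=
  rowMatrix_rowsX BB.bb756 bb756_A bb756_B

set_option maxRecDepth 100000 in -- as above
/-- **`rowMatrix 756 (rowsZ la756 lb756) = BB.bb756.HZFlat`**. -/
theorem rowsZ_bb756 : rowMatrix 756 (rowsZ la756 lb756) = BB.bb756.HZFlat :=
  rowMatrix_rowsZ BB.bb756 bb756_A bb756_B

set_option maxRecDepth 100000 in -- as above
/-- Commutation of the row words `H^X (H^Z)ᵀ = 0`, inherited from the typed code through the two identities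
(`BB.Code.HXFlat_mul_HZFlat_transpose`). -/
theorem comm_bb756 : rowMatrix 756 (rowsX la756 lb756) * (rowMatrix 756 (rowsZ la756 lb756))ᵀ = 0 := by
  rw [rowsX_bb756, rowsZ_bb756]
  exact BB.bb756.HXFlat_mul_HZFlat_transpose

end Summit.Ventures.QEC.Census.BB756
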